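import Summits.QuantumFields.BalabanUV.T4Continuum.Support.B13StepOfRecordSubstrateShiftLetters
import Summits.QuantumFields.BalabanUV.T4Continuum.Support.B13StepEnvelopeEndMeasOp

/-!
# NE5 ∕ U3 — E9[rec] (THE CAUCHY-ENVELOPE END OF RECORD) AT THE SUBSTRATE's COV-SHIFTED O1 INSTANCE `slotsOfRecordShift …` (W-21)

Cell `pub-balaban`, unit `b2b-balaban-t4-ne5-formalise-leaf-03` (NE5 formalisation swarm, LEAF PROVER 03, gen 16; lineage follower — the RE-POINTED
twin of this lineage's gen-11 `Support/B13StepEnvelopeEndSubstrate.lean` p222736; journal INTENT `HOME/CLAIMS.log` l.20304).  WHY: NE5 owner RULING R53 ∕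
F-ne5p1-g37-1 (l.19772), R54 (l.19952), substrate-typer (ν1) (l.19999): at the UNSHIFTED slots `slotsOfRecord …` run B's covariance species reads the SAME
depth as run A's, so the W1-cov comparison there is the letter-trivial same-level difference and the displayed tower-reading pair of the W1-produced ENDs is
jointly uninhabitable for towers with a level step; the substrate RE-POINTED run B's cov slot one level deeper at aligned index `k` — substrate-p1's W-21
`Support/SubstrateSlotsOfRecordShift.lean` (`rawBOfRecordShift`, `slotsOfRecordShift`; R54 (1) (α) COV-ONLY + rider) — and R54 (4) asks the leaf lineages
to re-point their ENDs.  THIS FILE re-points the E9 road's instance face: p222736 §1∕§2∕§3 with `slotsOfRecord ↦ slotsOfRecordShift` and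
`rawBOfRecord ι D … ↦ rawBOfRecordShift D ι …` (run B's letter condition `hbdB`), the memberships ∕ factor reading at the shifted slots from the three
letter lemmas `opA_mem_measOp_slotsOfRecordShift` ∕ `opB_mem_measOp_slotsOfRecordShift` ∕ `transportReads_slotsOfRecordShift_of_factor` BY NAME from their
ONE home `Support/B13StepOfRecordSubstrateShiftLetters.lean` (leaf-08-g13, journal l.20449; p221190 §1∕§2's twins at the shift, credit leaf-01-g11 —
nothing re-declared here).  Parents BY NAME, unchanged: this lineage's generic faces
`B13StepEnvelopeEndSub.ne5_ ∕ exists_ne5_of_record_restrict_envelope_actNormDecay` (p216841; generic `S₀ M hMA hMB hT`) and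
`B13StepEnvelopeEndMeasOp.exists_ne5_of_record_measOp_envelope_readAt` (p217285).  Summits-side NEW WORK under the LEAN PLACEMENT RULE (cell bookkeeping;
0 def; NOT a Literature module).
HONEST FRAMING: rung (B)+1 of the FINITE-VOLUME T⁴ continuum programme — NOT infinite volume, NOT a mass gap, NOT the Clay problem, and **NOT
A PROOF OF NE5** (NOT PRINTED: the series prints ε-UNIFORM bounds, never η-RATES; cell GAPS G-t4-U3-1): every theorem below is an IMPLICATION whose
wall binders — W2-op = `ActOpLineAnalyticOn` of the cores OF THE INSTANCE (read through `↥measOp → OpDatum`; GAPS G-ne5p1-1′∕1″, NOT PRINTED, NOT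
discharged), the per-activity norm majorant with decay split and anchored norm ((2.38)∕(1.26) KIND), W1 in row NE2's entry currency (the FREE displayed
binder `hwer`, now AT THE SHIFTED SLOTS — where the meaningful two-level W1-cov of record lives, R53 (3); produced from rows NE2 ∧ NE3's letters only in
the companion `B13StepEnvelopeEndSubstrateShiftBalaban`), W4, the one-run slice budgets (W3 KIND), the quoted levels L05∕L06 ([Balaban1987RG1] (1.18)
p. 263 SHAPE), the numerics, AND the substrate's LETTER CONDITIONS (format-boundedness of the raw records — run B's now of `rawBOfRecordShift` —,
measurability of the potential tables, factorisation of `iopA` through the transport) — are DISPLAYED HYPOTHESES about the substrate's displayed letters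
`L`, asserted nowhere (c3∕c4∕c6; R34: the instance is the substrate's, this file is the SOCKET side applied BY NAME; CLAIM RULE 5: no species is typed
here).  O-8-vol ∕ O-8-top riders (MAP §O1 v0.11) apply to the instance as the substrate states them; nothing of Bałaban's is asserted.
HONEST DEPENDENCY (cell line, verbatim): continuum YM on T⁴ ⇐ BetaPertH ∧ nine spine estimates (0/9 proved); BetaPertH ⇐ (D1) ∧ (D4) ∧
CAP+tail; G-an2-4 gates asym, D1 and NE2/3/4.

WHAT IS PROVED (kernel; `[folklore]`; each a ONE-LINE application of the parent BY NAME):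
* §1 **`ne5_of_substrateShift_restrict_envelope_actNormDecay`** — p216841's `ne5_of_record_restrict_envelope_actNormDecay` AT
  `S₀ := slotsOfRecordShift D ι c a s P 𝒵 dom Jc V mI L`, `M := measOp T κ ι′ Ω 𝒴`: `hMA`∕`hMB` from the six letter conditions at the shift, `hT`
  from the factorisation datum `(iopAt, hiopA)` (the insertion datum is `slotsOfRecord`'s, `slotsOfRecordShift_D`), margins ∕ age damping read off
  `L`; every other binder VERBATIM; conclusion LITERALLY `NE5 (B13StepOfRecord.outA (slotsOfRecordShift …) E₀ cB) (B13StepOfRecord.outB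
  (slotsOfRecordShift …) E₀ cB) W κ θ′ C₅` with E9[rec]'s `C₅` VERBATIM (p214842's).
* §2 **`exists_ne5_of_substrateShift_restrict_envelope_actNormDecay`** — the same with the arithmetic letters `ρ₀, k₀, B` ELIMINATED (p216841's
  `exists_…`: `0 < θ < 1` and the two strict size inequalities).
* §3 **`exists_ne5_of_substrateShift_measOp_envelope_readAt`** — p217285's most-reduced face AT the shifted instance READ AT THE TRANSPORTED
  BACKGROUND (`readAtSlots (slotsOfRecordShift …) ιbg`): NO reading datum at all, its eight measurability ∕ format binders ↦ the six letter conditions.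
CENSUS vs p222736 (binders, by name): IDENTICAL lists §1∕§2∕§3; the ONLY changes are the instance (`slotsOfRecord ↦ slotsOfRecordShift` in every
slot-bearing binder and in the conclusion) and `hbdB`'s subject (`rawBOfRecord ι D … ↦ rawBOfRecordShift D ι …`).  The η-uniform E9 faces (p218872 ∕
p218923) bind `S₀` INSIDE their `∃ C₅` and apply at the shifted instance by specialisation — nothing to file.  0 sorry; axioms ⊆ {propext,
Classical.choice, Quot.sound}.
-/

noncomputable section

open scoped BigOperators
open Metric Set MeasureTheory

namespace Summit.QuantumFields.BalabanUV.T4Continuum.B13StepEnvelopeEndSubstrateShift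

open Literature.MathematicalPhysics.QuantumFieldTheory.Balaban1983to89
open Literature.MathematicalPhysics.QuantumFieldTheory.Balaban1983to89.T4OutputRate (DecayBound NE5)
open Literature.MathematicalPhysics.QuantumFieldTheory.Balaban1983to89.T4InputCauchyRateSpecies (ballClass)
open Literature.MathematicalPhysics.QuantumFieldTheory.Balaban1983to89.B5Prop11Plancherel (Tor)
open Summit.QuantumFields.BalabanUV.T4Continuum.B13Carriers (TwoRuns)
open Summit.QuantumFields.BalabanUV.T4Continuum.B13OpDatum (OpDatum Species FormatBounded B13Weights)
open Summit.QuantumFields.BalabanUV.T4Continuum.B13OpDatumJunctions (opOf RawBounded WeightedEntrywiseRate)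
open Summit.QuantumFields.BalabanUV.T4Continuum.B13OpMeasurable (measOp)
open Summit.QuantumFields.BalabanUV.T4Continuum.B13HistMeasurable (MeasPotFrame B13HistM)
open Summit.QuantumFields.BalabanUV.T4Continuum.B13StepTermLabels (TermIdx InnerLabel)
open Summit.QuantumFields.BalabanUV.T4Continuum.B13StepTermFamily (ActData ActExpLinearOn)
open Summit.QuantumFields.BalabanUV.T4Continuum.B13StepTermSocket (labelsIndexing)
open Summit.QuantumFields.BalabanUV.T4Continuum.B13InnerData (Bnd b13InnerData)
open Summit.QuantumFields.BalabanUV.T4Continuum.UrsellTreeSum (ind)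
open Summit.QuantumFields.BalabanUV.T4Continuum.UrsellTermBudget (actSum)
open Summit.QuantumFields.BalabanUV.T4Continuum.B13DomainGeometryTR (SCube footprint domainGeometry)
open Summit.QuantumFields.BalabanUV.T4Continuum.B13Base (selfCtr)
open Summit.QuantumFields.BalabanUV.T4Continuum.B13StepOfRecord (Slots assembly step)
open Summit.QuantumFields.BalabanUV.T4Continuum.B13StepOfRecordSub (assemblyOn restrict)
open Summit.QuantumFields.BalabanUV.T4Continuum.B13StepOfRecordReadAt (readAtSlots)
open Summit.QuantumFields.BalabanUV.T4Continuum.B13TermOpEnvelope (ActOpLineAnalyticOn)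
open Summit.QuantumFields.BalabanUV.T4Continuum.B13StepEnvelopeEndSub (ne5_of_record_restrict_envelope_actNormDecay
  exists_ne5_of_record_restrict_envelope_actNormDecay)
open Summit.QuantumFields.BalabanUV.T4Continuum.B13StepEnvelopeEndMeasOp (exists_ne5_of_record_measOp_envelope_readAt)
open Summit.QuantumFields.BalabanUV.T4Continuum.B13StepOfRecordSubstrateShiftLetters (opA_mem_measOp_slotsOfRecordShift opB_mem_measOp_slotsOfRecordShift
  transportReads_slotsOfRecordShift_of_factor)
open Summit.QuantumFields.BalabanUV.T4Continuum.SubstrateBackgroundTransporters (unitMod)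
open Summit.QuantumFields.BalabanUV.T4Continuum.SubstrateTwoRunsDriven (DrivenRuns)
open Summit.QuantumFields.BalabanUV.T4Continuum.SubstrateRawSpecies (rawAOfRecord rawBOfRecord)
open Summit.QuantumFields.BalabanUV.T4Continuum.SubstrateSlotsOfRecord (SpeciesRec SlotLetters slotsOfRecord)
open Summit.QuantumFields.BalabanUV.T4Continuum.SubstrateSlotsOfRecordShift (rawBOfRecordShift slotsOfRecordShift)

variable {G : Type} [GaugeGroup G] (D : DrivenRuns G)
variable {o : Type} [Fintype o] [DecidableEq o] (ι : G →* Matrix o o ℂ) (c : ℂ) (a : ℝ) (s : ℕ → ℂ)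
variable {T ι' S Ω 𝒴 : Type} [MeasurableSpace Ω] (P : MeasPotFrame D.carriers) {IOp : Type*}
  (𝒵 : D.carriers.Dom → InnerLabel D.carriers.Dom (Bnd D.toTwoRuns) → Type) [∀ Z j, Fintype (𝒵 Z j)] (dom : ∀ Z j, 𝒵 Z j → D.carriers.Dom)
  (Jc : D.carriers.Dom → InnerLabel D.carriers.Dom (Bnd D.toTwoRuns) → Type) [∀ Z j, Fintype (Jc Z j)]
  (V : D.carriers.Dom → InnerLabel D.carriers.Dom (Bnd D.toTwoRuns) → Type) [∀ Z j, NormedAddCommGroup (V Z j)]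
  [∀ Z j, InnerProductSpace ℝ (V Z j)] [∀ Z j, MeasurableSpace (V Z j)] [∀ Z j, BorelSpace (V Z j)] [∀ Z j, FiniteDimensional ℝ (V Z j)]
  (mI : D.carriers.Dom → InnerLabel D.carriers.Dom (Bnd D.toTwoRuns) → Type) [∀ Z j, Fintype (mI Z j)] [∀ Z j, DecidableEq (mI Z j)]
variable (L : SlotLetters D (o := o) (T := T) (ι' := ι') (S := S) (Ω := Ω) (𝒴 := 𝒴) P (IOp := IOp) 𝒵 dom Jc V mI)
variable {Ω' : Type*} [MeasurableSpace Ω'] (E₀ cB : ℝ)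

/-! ## §1 E9[rec] AT THE SUBSTRATE's COV-SHIFTED SLOTS OF RECORD on the measurable operator carrier -/

/-- [folklore] **E9[rec] (CAUCHY-ENVELOPE END OF RECORD) AT THE SUBSTRATE's COV-SHIFTED O1 INSTANCE** — p216841's
`ne5_of_record_restrict_envelope_actNormDecay` at `S₀ := slotsOfRecordShift D ι c a s P 𝒵 dom Jc V mI L` (W-21), `M := measOp`: the membership
side conditions from the six LETTER conditions at the shift (`hbdB` about `rawBOfRecordShift`; p221190 §1's twins BY NAME), the L01 reading from the
factorisation datum `(iopAt, hiopA)` (p221190 §2's twin BY NAME), margins and age damping read off the letters (`L.rOp`, `L.rHist`, `L.ins.ω`);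
EVERY OTHER BINDER of p216841 VERBATIM at the shifted instance (the per-activity norm majorant, **`ActOpLineAnalyticOn`** and `ActExpLinearOn`
about the cores OF THE INSTANCE read through `↥measOp → OpDatum` — the `act` slot is `slotsOfRecord`'s, `slotsOfRecordShift_act`); conclusion
LITERALLY `NE5 (B13StepOfRecord.outA (slotsOfRecordShift …) E₀ cB) (B13StepOfRecord.outB (slotsOfRecordShift …) E₀ cB) W κ θ′ C₅` with E9[rec]'s
`C₅` VERBATIM.  NOT a proof of NE5; nothing of the substrate's letters is asserted. -/
theorem ne5_of_substrateShift_restrict_envelope_actNormDecay {W : Set (ℕ → ℝ)} {ROp RHist : ℕ → ℝ}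
    {A A' : ℕ → (ℕ → ℝ) → D.toTwoRuns.carriers.BgB → D.toTwoRuns.carriers.Dom → InnerLabel D.toTwoRuns.carriers.Dom (Bnd D.toTwoRuns) → ℝ}
    {Dt : ActData D.toTwoRuns.carriers.Dom (InnerLabel D.toTwoRuns.carriers.Dom (Bnd D.toTwoRuns)) (measOp T ((Tor (unitMod (D.F.P D.K)) × Fin (D.F.P D.K).d) × o) ι' Ω 𝒴) (B13HistM P) Ω'}
    {κ Φ' EA₀ E₁ cA c₁ r₀ δ' θ θ' ρ₀ B : ℝ} {k₀ : ℕ}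
    -- the six LETTER conditions at the shifted slots (replace `hMA` ∕ `hMB`; p221190 §1's twins — run B's about `rawBOfRecordShift`)
    (hbdA : ∀ (g : ℕ → ℝ) (U : D.carriers.BgA) (k : ℕ),
      FormatBounded (L.W k).format (rawAOfRecord ι D c a s L.ΓA L.dkA L.gcA L.pQA L.pRA g U k).kernel)
    (hmQA : ∀ (r : ℝ) (U : GaugeField (D.F.P D.K) 0 G) (k : ℕ) (Y : 𝒴) (b b' : ((Tor (unitMod (D.F.P D.K)) × Fin (D.F.P D.K).d) × o)),
        Measurable fun x : Ω => L.pQA r U k x Y b b')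
    (hmRA : ∀ (r : ℝ) (U : GaugeField (D.F.P D.K) 0 G) (k : ℕ) (Y : 𝒴), Measurable fun x : Ω => L.pRA r U k x Y)
    (hbdB : ∀ (g : ℕ → ℝ) (U : D.carriers.BgB) (k : ℕ),
      FormatBounded (L.W k).format (rawBOfRecordShift D ι c a s L.ΓB L.dkB L.gcB L.pQB L.pRB g U k).kernel)
    (hmQB : ∀ (r : ℝ) (U : GaugeField (D.F.P (D.K + 1)) 0 G) (k : ℕ) (Y : 𝒴) (b b' : ((Tor (unitMod (D.F.P D.K)) × Fin (D.F.P D.K).d) × o)),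
        Measurable fun x : Ω => L.pQB r U k x Y b b')
    (hmRB : ∀ (r : ℝ) (U : GaugeField (D.F.P (D.K + 1)) 0 G) (k : ℕ) (Y : 𝒴), Measurable fun x : Ω => L.pRB r U k x Y)
    -- leaf-01-g11's factorisation datum (replaces the L01 reading `hT`; p221190 §2's twin — the insertion datum is unchanged by the shift)
    (iopAt : ℝ → D.carriers.BgA → ℕ → IOp)
    (hiopA : ∀ (r : ℝ) (U : D.carriers.BgB) (k : ℕ), L.ins.iopA r U k = iopAt r (D.carriers.transport U) k)
    -- E9[rec]'s binders VERBATIM at the instance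
    (hbB : (assembly (slotsOfRecordShift D ι c a s P 𝒵 dom Jc V mI L)).SliceBudgetB W κ cB)
    (hbA : (slotsOfRecordShift D ι c a s P 𝒵 dom Jc V mI L).D.SliceBudget (step (slotsOfRecordShift D ι c a s P 𝒵 dom Jc V mI L) E₀ cB) W κ cA)
    (hdA : DecayBound (B13StepOfRecord.outA (slotsOfRecordShift D ι c a s P 𝒵 dom Jc V mI L) E₀ cB) W EA₀ κ)
    (hdB : DecayBound (B13StepOfRecord.outB (slotsOfRecordShift D ι c a s P 𝒵 dom Jc V mI L) E₀ cB) W E₀ κ)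
    (hRA : RawBounded (slotsOfRecordShift D ι c a s P 𝒵 dom Jc V mI L).F (assembly (slotsOfRecordShift D ι c a s P 𝒵 dom Jc V mI L)).rawAt W)
    (hRB : RawBounded (slotsOfRecordShift D ι c a s P 𝒵 dom Jc V mI L).F (slotsOfRecordShift D ι c a s P 𝒵 dom Jc V mI L).rawB W)
    (hwer : WeightedEntrywiseRate (slotsOfRecordShift D ι c a s P 𝒵 dom Jc V mI L).F (assembly (slotsOfRecordShift D ι c a s P 𝒵 dom Jc V mI L)).rawAt (slotsOfRecordShift D ι c a s P 𝒵 dom Jc V mI L).rawB W c₁ fun k => θ ^ k)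
    (hfl : ∀ k, r₀ ≤ L.rOp k)
    (hins : (step (slotsOfRecordShift D ι c a s P 𝒵 dom Jc V mI L) E₀ cB).InsertionRate W κ E₀ δ' θ)
    (hOp : ∀ k, L.rOp k ≤ ROp k) (hHist : ∀ k, (assembly (slotsOfRecordShift D ι c a s P 𝒵 dom Jc V mI L)).bHist E₀ cB k + L.rHist k ≤ RHist k)
    (hA : ∀ k, ∀ g ∈ W, ∀ (U : D.toTwoRuns.carriers.BgB) (q : (measOp T ((Tor (unitMod (D.F.P D.K)) × Fin (D.F.P D.K).d) × o) ι' Ω 𝒴) × B13HistM P),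
      q ∈ (ballClass (selfCtr (assemblyOn (restrict (slotsOfRecordShift D ι c a s P 𝒵 dom Jc V mI L) (measOp T ((Tor (unitMod (D.F.P D.K)) × Fin (D.F.P D.K).d) × o) ι' Ω 𝒴)
          (opA_mem_measOp_slotsOfRecordShift D ι c a s P 𝒵 dom Jc V mI L hbdA hmQA hmRA)
          (opB_mem_measOp_slotsOfRecordShift D ι c a s P 𝒵 dom Jc V mI L hbdB hmQB hmRB))).raw
        (assemblyOn (restrict (slotsOfRecordShift D ι c a s P 𝒵 dom Jc V mI L) (measOp T ((Tor (unitMod (D.F.P D.K)) × Fin (D.F.P D.K).d) × o) ι' Ω 𝒴)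
          (opA_mem_measOp_slotsOfRecordShift D ι c a s P 𝒵 dom Jc V mI L hbdA hmQA hmRA)
          (opB_mem_measOp_slotsOfRecordShift D ι c a s P 𝒵 dom Jc V mI L hbdB hmQB hmRB))).histRef) ROp RHist) k g U →
        ∀ X : D.toTwoRuns.carriers.Dom, D.toTwoRuns.carriers.scale X = k → ∀ i : TermIdx D.toTwoRuns.carriers.Dom (Bnd D.toTwoRuns),
          (labelsIndexing (domainGeometry D.toTwoRuns) (b13InnerData D.toTwoRuns)).Rel k i X → ∀ m,
            ‖(slotsOfRecordShift D ι c a s P 𝒵 dom Jc V mI L).act ((labelsIndexing (domainGeometry D.toTwoRuns) (b13InnerData D.toTwoRuns)).poly i m) ((labelsIndexing (domainGeometry D.toTwoRuns) (b13InnerData D.toTwoRuns)).lab i m) (q.1 : OpDatum (SpeciesRec D o T ι' Ω 𝒴)) q.2‖ ≤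
              A k g U ((labelsIndexing (domainGeometry D.toTwoRuns) (b13InnerData D.toTwoRuns)).poly i m) ((labelsIndexing (domainGeometry D.toTwoRuns) (b13InnerData D.toTwoRuns)).lab i m))
    (hA0 : ∀ k g U Z ℓ, 0 ≤ A k g U Z ℓ) (hA0' : ∀ k g U Z ℓ, 0 ≤ A' k g U Z ℓ) (hκ : 0 ≤ κ)
    (hdec : ∀ k g U Z ℓ, A k g U Z ℓ ≤ A' k g U Z ℓ * Real.exp (-(κ * (D.toTwoRuns.carriers.d Z + 5))))
    (hΦ0 : 0 ≤ Φ') (hΦsmall : 36 * Φ' < 1)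
    (hΦ : ∀ k, ∀ g ∈ W, ∀ (U : D.toTwoRuns.carriers.BgB) (q : SCube D.toTwoRuns),
      ∑ Z ∈ D.toTwoRuns.domAt k, ind (q ∈ footprint Z) * actSum (b13InnerData D.toTwoRuns) (A' k g U) k Z *
        Real.exp ((footprint Z).card) ≤ Φ')
    (hact : ActOpLineAnalyticOn (labelsIndexing (domainGeometry D.toTwoRuns) (b13InnerData D.toTwoRuns)) (restrict (slotsOfRecordShift D ι c a s P 𝒵 dom Jc V mI L) (measOp T ((Tor (unitMod (D.F.P D.K)) × Fin (D.F.P D.K).d) × o) ι' Ω 𝒴)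
          (opA_mem_measOp_slotsOfRecordShift D ι c a s P 𝒵 dom Jc V mI L hbdA hmQA hmRA)
          (opB_mem_measOp_slotsOfRecordShift D ι c a s P 𝒵 dom Jc V mI L hbdB hmQB hmRB)).act
      (ballClass (selfCtr (assemblyOn (restrict (slotsOfRecordShift D ι c a s P 𝒵 dom Jc V mI L) (measOp T ((Tor (unitMod (D.F.P D.K)) × Fin (D.F.P D.K).d) × o) ι' Ω 𝒴)
          (opA_mem_measOp_slotsOfRecordShift D ι c a s P 𝒵 dom Jc V mI L hbdA hmQA hmRA)
          (opB_mem_measOp_slotsOfRecordShift D ι c a s P 𝒵 dom Jc V mI L hbdB hmQB hmRB))).raw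
        (assemblyOn (restrict (slotsOfRecordShift D ι c a s P 𝒵 dom Jc V mI L) (measOp T ((Tor (unitMod (D.F.P D.K)) × Fin (D.F.P D.K).d) × o) ι' Ω 𝒴)
          (opA_mem_measOp_slotsOfRecordShift D ι c a s P 𝒵 dom Jc V mI L hbdA hmQA hmRA)
          (opB_mem_measOp_slotsOfRecordShift D ι c a s P 𝒵 dom Jc V mI L hbdB hmQB hmRB))).histRef) ROp RHist) W)
    (hexp : ActExpLinearOn (labelsIndexing (domainGeometry D.toTwoRuns) (b13InnerData D.toTwoRuns)) (restrict (slotsOfRecordShift D ι c a s P 𝒵 dom Jc V mI L) (measOp T ((Tor (unitMod (D.F.P D.K)) × Fin (D.F.P D.K).d) × o) ι' Ω 𝒴)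
          (opA_mem_measOp_slotsOfRecordShift D ι c a s P 𝒵 dom Jc V mI L hbdA hmQA hmRA)
          (opB_mem_measOp_slotsOfRecordShift D ι c a s P 𝒵 dom Jc V mI L hbdB hmQB hmRB)).act Dt
      (ballClass (selfCtr (assemblyOn (restrict (slotsOfRecordShift D ι c a s P 𝒵 dom Jc V mI L) (measOp T ((Tor (unitMod (D.F.P D.K)) × Fin (D.F.P D.K).d) × o) ι' Ω 𝒴)
          (opA_mem_measOp_slotsOfRecordShift D ι c a s P 𝒵 dom Jc V mI L hbdA hmQA hmRA)
          (opB_mem_measOp_slotsOfRecordShift D ι c a s P 𝒵 dom Jc V mI L hbdB hmQB hmRB))).raw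
        (assemblyOn (restrict (slotsOfRecordShift D ι c a s P 𝒵 dom Jc V mI L) (measOp T ((Tor (unitMod (D.F.P D.K)) × Fin (D.F.P D.K).d) × o) ι' Ω 𝒴)
          (opA_mem_measOp_slotsOfRecordShift D ι c a s P 𝒵 dom Jc V mI L hbdA hmQA hmRA)
          (opB_mem_measOp_slotsOfRecordShift D ι c a s P 𝒵 dom Jc V mI L hbdB hmQB hmRB))).histRef) ROp RHist) W)
    (hE₀ : 0 ≤ E₀) (hE₁ : 0 < E₁) (hcA : 0 ≤ cA) (hcB : 0 ≤ cB) (hc₁ : 0 ≤ c₁) (hr₀ : 0 < r₀) (hδ' : 0 ≤ δ')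
    (hθ : 0 ≤ θ) (hθθ' : θ ≤ θ') (hθ'1 : θ' ≤ 1) (hω : 0 < L.ins.ω) (hω1 : L.ins.ω < 1) (hρ₀ : ρ₀ < 1)
    (hnear : (c₁ / r₀ + δ') * θ ^ k₀ + cA * (EA₀ + E₀) / (1 - L.ins.ω) ≤ ρ₀) (hB : 0 ≤ B)
    (hfirst : ∀ k < k₀, EA₀ + E₀ ≤ B * θ ^ k) (hsmall : L.ins.ω + Φ' / (1 - 36 * Φ') / (1 - ρ₀) * cA < θ') :
    NE5 (B13StepOfRecord.outA (slotsOfRecordShift D ι c a s P 𝒵 dom Jc V mI L) E₀ cB) (B13StepOfRecord.outB (slotsOfRecordShift D ι c a s P 𝒵 dom Jc V mI L) E₀ cB) W κ θ'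
      ((Φ' / (1 - 36 * Φ') / (1 - ρ₀) * (c₁ / r₀) + Φ' / (1 - 36 * Φ') / (1 - ρ₀) * δ' + B) * (θ' - L.ins.ω) /
        (θ' - (L.ins.ω + Φ' / (1 - 36 * Φ') / (1 - ρ₀) * cA))) :=
  ne5_of_record_restrict_envelope_actNormDecay (slotsOfRecordShift D ι c a s P 𝒵 dom Jc V mI L) (measOp T ((Tor (unitMod (D.F.P D.K)) × Fin (D.F.P D.K).d) × o) ι' Ω 𝒴)
    (opA_mem_measOp_slotsOfRecordShift D ι c a s P 𝒵 dom Jc V mI L hbdA hmQA hmRA)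
    (opB_mem_measOp_slotsOfRecordShift D ι c a s P 𝒵 dom Jc V mI L hbdB hmQB hmRB) E₀ cB
    (transportReads_slotsOfRecordShift_of_factor D ι c a s P 𝒵 dom Jc V mI L iopAt hiopA W) hbB hbA hdA hdB hRA hRB hwer hfl hins hOp hHist hA
    hA0 hA0' hκ hdec hΦ0 hΦsmall hΦ hact hexp hE₀ hE₁ hcA hcB hc₁ hr₀ hδ' hθ hθθ' hθ'1 hω hω1 hρ₀ hnear hB hfirst hsmall

/-! ## §2 The same with the arithmetic letters eliminated -/

/-- [folklore] **E9[rec] AT THE SUBSTRATE's COV-SHIFTED O1 INSTANCE, ARITHMETIC LETTERS ELIMINATED** — p216841's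
`exists_ne5_of_record_restrict_envelope_actNormDecay` at the shifted instance: §1's binders with `ρ₀, k₀, B` REPLACED by `0 < θ < 1` and the
two strict size inequalities (sharp, leaf-10's `reach_elim_iff`); `∃ C₅, NE5 (B13StepOfRecord.outA (slotsOfRecordShift …) E₀ cB)
(B13StepOfRecord.outB (slotsOfRecordShift …) E₀ cB) W κ θ′ C₅`.  NOT a proof of NE5. -/
theorem exists_ne5_of_substrateShift_restrict_envelope_actNormDecay {W : Set (ℕ → ℝ)} {ROp RHist : ℕ → ℝ}
    {A A' : ℕ → (ℕ → ℝ) → D.toTwoRuns.carriers.BgB → D.toTwoRuns.carriers.Dom → InnerLabel D.toTwoRuns.carriers.Dom (Bnd D.toTwoRuns) → ℝ}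
    {Dt : ActData D.toTwoRuns.carriers.Dom (InnerLabel D.toTwoRuns.carriers.Dom (Bnd D.toTwoRuns)) (measOp T ((Tor (unitMod (D.F.P D.K)) × Fin (D.F.P D.K).d) × o) ι' Ω 𝒴) (B13HistM P) Ω'}
    {κ Φ' EA₀ cA c₁ r₀ δ' θ θ' : ℝ}
    -- the six LETTER conditions at the shifted slots (replace `hMA` ∕ `hMB`; p221190 §1's twins — run B's about `rawBOfRecordShift`)
    (hbdA : ∀ (g : ℕ → ℝ) (U : D.carriers.BgA) (k : ℕ),
      FormatBounded (L.W k).format (rawAOfRecord ι D c a s L.ΓA L.dkA L.gcA L.pQA L.pRA g U k).kernel)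
    (hmQA : ∀ (r : ℝ) (U : GaugeField (D.F.P D.K) 0 G) (k : ℕ) (Y : 𝒴) (b b' : ((Tor (unitMod (D.F.P D.K)) × Fin (D.F.P D.K).d) × o)),
        Measurable fun x : Ω => L.pQA r U k x Y b b')
    (hmRA : ∀ (r : ℝ) (U : GaugeField (D.F.P D.K) 0 G) (k : ℕ) (Y : 𝒴), Measurable fun x : Ω => L.pRA r U k x Y)
    (hbdB : ∀ (g : ℕ → ℝ) (U : D.carriers.BgB) (k : ℕ),
      FormatBounded (L.W k).format (rawBOfRecordShift D ι c a s L.ΓB L.dkB L.gcB L.pQB L.pRB g U k).kernel)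
    (hmQB : ∀ (r : ℝ) (U : GaugeField (D.F.P (D.K + 1)) 0 G) (k : ℕ) (Y : 𝒴) (b b' : ((Tor (unitMod (D.F.P D.K)) × Fin (D.F.P D.K).d) × o)),
        Measurable fun x : Ω => L.pQB r U k x Y b b')
    (hmRB : ∀ (r : ℝ) (U : GaugeField (D.F.P (D.K + 1)) 0 G) (k : ℕ) (Y : 𝒴), Measurable fun x : Ω => L.pRB r U k x Y)
    -- leaf-01-g11's factorisation datum (replaces the L01 reading `hT`; p221190 §2's twin — the insertion datum is unchanged by the shift)
    (iopAt : ℝ → D.carriers.BgA → ℕ → IOp)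
    (hiopA : ∀ (r : ℝ) (U : D.carriers.BgB) (k : ℕ), L.ins.iopA r U k = iopAt r (D.carriers.transport U) k)
    -- E9[rec]'s binders VERBATIM at the instance
    (hbB : (assembly (slotsOfRecordShift D ι c a s P 𝒵 dom Jc V mI L)).SliceBudgetB W κ cB)
    (hbA : (slotsOfRecordShift D ι c a s P 𝒵 dom Jc V mI L).D.SliceBudget (step (slotsOfRecordShift D ι c a s P 𝒵 dom Jc V mI L) E₀ cB) W κ cA)
    (hdA : DecayBound (B13StepOfRecord.outA (slotsOfRecordShift D ι c a s P 𝒵 dom Jc V mI L) E₀ cB) W EA₀ κ)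
    (hdB : DecayBound (B13StepOfRecord.outB (slotsOfRecordShift D ι c a s P 𝒵 dom Jc V mI L) E₀ cB) W E₀ κ)
    (hRA : RawBounded (slotsOfRecordShift D ι c a s P 𝒵 dom Jc V mI L).F (assembly (slotsOfRecordShift D ι c a s P 𝒵 dom Jc V mI L)).rawAt W)
    (hRB : RawBounded (slotsOfRecordShift D ι c a s P 𝒵 dom Jc V mI L).F (slotsOfRecordShift D ι c a s P 𝒵 dom Jc V mI L).rawB W)
    (hwer : WeightedEntrywiseRate (slotsOfRecordShift D ι c a s P 𝒵 dom Jc V mI L).F (assembly (slotsOfRecordShift D ι c a s P 𝒵 dom Jc V mI L)).rawAt (slotsOfRecordShift D ι c a s P 𝒵 dom Jc V mI L).rawB W c₁ fun k => θ ^ k)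
    (hfl : ∀ k, r₀ ≤ L.rOp k)
    (hins : (step (slotsOfRecordShift D ι c a s P 𝒵 dom Jc V mI L) E₀ cB).InsertionRate W κ E₀ δ' θ)
    (hOp : ∀ k, L.rOp k ≤ ROp k) (hHist : ∀ k, (assembly (slotsOfRecordShift D ι c a s P 𝒵 dom Jc V mI L)).bHist E₀ cB k + L.rHist k ≤ RHist k)
    (hA : ∀ k, ∀ g ∈ W, ∀ (U : D.toTwoRuns.carriers.BgB) (q : (measOp T ((Tor (unitMod (D.F.P D.K)) × Fin (D.F.P D.K).d) × o) ι' Ω 𝒴) × B13HistM P),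
      q ∈ (ballClass (selfCtr (assemblyOn (restrict (slotsOfRecordShift D ι c a s P 𝒵 dom Jc V mI L) (measOp T ((Tor (unitMod (D.F.P D.K)) × Fin (D.F.P D.K).d) × o) ι' Ω 𝒴)
          (opA_mem_measOp_slotsOfRecordShift D ι c a s P 𝒵 dom Jc V mI L hbdA hmQA hmRA)
          (opB_mem_measOp_slotsOfRecordShift D ι c a s P 𝒵 dom Jc V mI L hbdB hmQB hmRB))).raw
        (assemblyOn (restrict (slotsOfRecordShift D ι c a s P 𝒵 dom Jc V mI L) (measOp T ((Tor (unitMod (D.F.P D.K)) × Fin (D.F.P D.K).d) × o) ι' Ω 𝒴)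
          (opA_mem_measOp_slotsOfRecordShift D ι c a s P 𝒵 dom Jc V mI L hbdA hmQA hmRA)
          (opB_mem_measOp_slotsOfRecordShift D ι c a s P 𝒵 dom Jc V mI L hbdB hmQB hmRB))).histRef) ROp RHist) k g U →
        ∀ X : D.toTwoRuns.carriers.Dom, D.toTwoRuns.carriers.scale X = k → ∀ i : TermIdx D.toTwoRuns.carriers.Dom (Bnd D.toTwoRuns),
          (labelsIndexing (domainGeometry D.toTwoRuns) (b13InnerData D.toTwoRuns)).Rel k i X → ∀ m,
            ‖(slotsOfRecordShift D ι c a s P 𝒵 dom Jc V mI L).act ((labelsIndexing (domainGeometry D.toTwoRuns) (b13InnerData D.toTwoRuns)).poly i m) ((labelsIndexing (domainGeometry D.toTwoRuns) (b13InnerData D.toTwoRuns)).lab i m) (q.1 : OpDatum (SpeciesRec D o T ι' Ω 𝒴)) q.2‖ ≤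
              A k g U ((labelsIndexing (domainGeometry D.toTwoRuns) (b13InnerData D.toTwoRuns)).poly i m) ((labelsIndexing (domainGeometry D.toTwoRuns) (b13InnerData D.toTwoRuns)).lab i m))
    (hA0 : ∀ k g U Z ℓ, 0 ≤ A k g U Z ℓ) (hA0' : ∀ k g U Z ℓ, 0 ≤ A' k g U Z ℓ) (hκ : 0 ≤ κ)
    (hdec : ∀ k g U Z ℓ, A k g U Z ℓ ≤ A' k g U Z ℓ * Real.exp (-(κ * (D.toTwoRuns.carriers.d Z + 5))))
    (hΦ0 : 0 ≤ Φ') (hΦsmall : 36 * Φ' < 1)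
    (hΦ : ∀ k, ∀ g ∈ W, ∀ (U : D.toTwoRuns.carriers.BgB) (q : SCube D.toTwoRuns),
      ∑ Z ∈ D.toTwoRuns.domAt k, ind (q ∈ footprint Z) * actSum (b13InnerData D.toTwoRuns) (A' k g U) k Z *
        Real.exp ((footprint Z).card) ≤ Φ')
    (hact : ActOpLineAnalyticOn (labelsIndexing (domainGeometry D.toTwoRuns) (b13InnerData D.toTwoRuns)) (restrict (slotsOfRecordShift D ι c a s P 𝒵 dom Jc V mI L) (measOp T ((Tor (unitMod (D.F.P D.K)) × Fin (D.F.P D.K).d) × o) ι' Ω 𝒴)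
          (opA_mem_measOp_slotsOfRecordShift D ι c a s P 𝒵 dom Jc V mI L hbdA hmQA hmRA)
          (opB_mem_measOp_slotsOfRecordShift D ι c a s P 𝒵 dom Jc V mI L hbdB hmQB hmRB)).act
      (ballClass (selfCtr (assemblyOn (restrict (slotsOfRecordShift D ι c a s P 𝒵 dom Jc V mI L) (measOp T ((Tor (unitMod (D.F.P D.K)) × Fin (D.F.P D.K).d) × o) ι' Ω 𝒴)
          (opA_mem_measOp_slotsOfRecordShift D ι c a s P 𝒵 dom Jc V mI L hbdA hmQA hmRA)
          (opB_mem_measOp_slotsOfRecordShift D ι c a s P 𝒵 dom Jc V mI L hbdB hmQB hmRB))).raw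
        (assemblyOn (restrict (slotsOfRecordShift D ι c a s P 𝒵 dom Jc V mI L) (measOp T ((Tor (unitMod (D.F.P D.K)) × Fin (D.F.P D.K).d) × o) ι' Ω 𝒴)
          (opA_mem_measOp_slotsOfRecordShift D ι c a s P 𝒵 dom Jc V mI L hbdA hmQA hmRA)
          (opB_mem_measOp_slotsOfRecordShift D ι c a s P 𝒵 dom Jc V mI L hbdB hmQB hmRB))).histRef) ROp RHist) W)
    (hexp : ActExpLinearOn (labelsIndexing (domainGeometry D.toTwoRuns) (b13InnerData D.toTwoRuns)) (restrict (slotsOfRecordShift D ι c a s P 𝒵 dom Jc V mI L) (measOp T ((Tor (unitMod (D.F.P D.K)) × Fin (D.F.P D.K).d) × o) ι' Ω 𝒴)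
          (opA_mem_measOp_slotsOfRecordShift D ι c a s P 𝒵 dom Jc V mI L hbdA hmQA hmRA)
          (opB_mem_measOp_slotsOfRecordShift D ι c a s P 𝒵 dom Jc V mI L hbdB hmQB hmRB)).act Dt
      (ballClass (selfCtr (assemblyOn (restrict (slotsOfRecordShift D ι c a s P 𝒵 dom Jc V mI L) (measOp T ((Tor (unitMod (D.F.P D.K)) × Fin (D.F.P D.K).d) × o) ι' Ω 𝒴)
          (opA_mem_measOp_slotsOfRecordShift D ι c a s P 𝒵 dom Jc V mI L hbdA hmQA hmRA)
          (opB_mem_measOp_slotsOfRecordShift D ι c a s P 𝒵 dom Jc V mI L hbdB hmQB hmRB))).raw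
        (assemblyOn (restrict (slotsOfRecordShift D ι c a s P 𝒵 dom Jc V mI L) (measOp T ((Tor (unitMod (D.F.P D.K)) × Fin (D.F.P D.K).d) × o) ι' Ω 𝒴)
          (opA_mem_measOp_slotsOfRecordShift D ι c a s P 𝒵 dom Jc V mI L hbdA hmQA hmRA)
          (opB_mem_measOp_slotsOfRecordShift D ι c a s P 𝒵 dom Jc V mI L hbdB hmQB hmRB))).histRef) ROp RHist) W)
    (hE₀ : 0 ≤ E₀) (hcA : 0 ≤ cA) (hcB : 0 ≤ cB) (hc₁ : 0 ≤ c₁) (hr₀ : 0 < r₀) (hδ' : 0 ≤ δ')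
    (hθ0 : 0 < θ) (hθ1 : θ < 1) (hθθ' : θ ≤ θ') (hθ'1 : θ' ≤ 1) (hω : 0 < L.ins.ω) (hω1 : L.ins.ω < 1)
    (hh : cA * (EA₀ + E₀) < 1 - L.ins.ω)
    (hsmall : L.ins.ω + Φ' / (1 - 36 * Φ') * cA * (1 - L.ins.ω) / (1 - L.ins.ω - cA * (EA₀ + E₀)) < θ') :
    ∃ C₅, NE5 (B13StepOfRecord.outA (slotsOfRecordShift D ι c a s P 𝒵 dom Jc V mI L) E₀ cB) (B13StepOfRecord.outB (slotsOfRecordShift D ι c a s P 𝒵 dom Jc V mI L) E₀ cB) W κ θ' C₅ :=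
  exists_ne5_of_record_restrict_envelope_actNormDecay (slotsOfRecordShift D ι c a s P 𝒵 dom Jc V mI L) (measOp T ((Tor (unitMod (D.F.P D.K)) × Fin (D.F.P D.K).d) × o) ι' Ω 𝒴)
    (opA_mem_measOp_slotsOfRecordShift D ι c a s P 𝒵 dom Jc V mI L hbdA hmQA hmRA)
    (opB_mem_measOp_slotsOfRecordShift D ι c a s P 𝒵 dom Jc V mI L hbdB hmQB hmRB) E₀ cB
    (transportReads_slotsOfRecordShift_of_factor D ι c a s P 𝒵 dom Jc V mI L iopAt hiopA W) hbB hbA hdA hdB hRA hRB hwer hfl hins hOp hHist hA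
    hA0 hA0' hκ hdec hΦ0 hΦsmall hΦ hact hexp hE₀ hcA hcB hc₁ hr₀ hδ' hθ0 hθ1 hθθ' hθ'1 hω hω1 hh hsmall

/-! ## §3 The most-reduced face: the instance READ AT THE TRANSPORTED BACKGROUND — no reading datum -/

/-- [folklore] **E9[rec] AT THE SUBSTRATE's COV-SHIFTED O1 INSTANCE READ AT THE TRANSPORTED BACKGROUND** — p217285's
`exists_ne5_of_record_measOp_envelope_readAt` at `S₀ := slotsOfRecordShift …`: for ANY run-A insertion-operator table `ιbg` on run A's OWN
backgrounds, the slot package `readAtSlots (slotsOfRecordShift …) ιbg` (insertion operators of run A read at `D.carriers.transport U` BY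
CONSTRUCTION — so the L01 reading needs NO datum) satisfies
`∃ C₅, NE5 (outA (readAtSlots (slotsOfRecordShift …) ιbg) E₀ cB) (outB (readAtSlots (slotsOfRecordShift …) ιbg) E₀ cB) W κ θ′ C₅` from: the six
LETTER conditions at the shift (the formats' potential weights are `x`-free by construction), the displayed slice budgets, levels, W1 entry data +
floor, W4, room, the activity norm majorant of the cores of the instance through `↥measOp → OpDatum` with decay split + anchored norm,
**`ActOpLineAnalyticOn`**, `ActExpLinearOn`, signs and the two strict size inequalities.  NOT a proof of NE5. -/
theorem exists_ne5_of_substrateShift_measOp_envelope_readAt (ιbg : (ℕ → ℝ) → D.carriers.BgA → ℕ → IOp) {W : Set (ℕ → ℝ)}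
    {ROp RHist : ℕ → ℝ}
    {A A' : ℕ → (ℕ → ℝ) → D.toTwoRuns.carriers.BgB → D.toTwoRuns.carriers.Dom → InnerLabel D.toTwoRuns.carriers.Dom (Bnd D.toTwoRuns) → ℝ}
    {Dt : ActData D.toTwoRuns.carriers.Dom (InnerLabel D.toTwoRuns.carriers.Dom (Bnd D.toTwoRuns)) (measOp T ((Tor (unitMod (D.F.P D.K)) × Fin (D.F.P D.K).d) × o) ι' Ω 𝒴) (B13HistM P) Ω'}
    {κ Φ' EA₀ cA c₁ r₀ δ' θ θ' : ℝ}
    -- the six LETTER conditions at the shifted slots (replace `hMA` ∕ `hMB`; p221190 §1's twins — run B's about `rawBOfRecordShift`)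
    (hbdA : ∀ (g : ℕ → ℝ) (U : D.carriers.BgA) (k : ℕ),
      FormatBounded (L.W k).format (rawAOfRecord ι D c a s L.ΓA L.dkA L.gcA L.pQA L.pRA g U k).kernel)
    (hmQA : ∀ (r : ℝ) (U : GaugeField (D.F.P D.K) 0 G) (k : ℕ) (Y : 𝒴) (b b' : ((Tor (unitMod (D.F.P D.K)) × Fin (D.F.P D.K).d) × o)),
        Measurable fun x : Ω => L.pQA r U k x Y b b')
    (hmRA : ∀ (r : ℝ) (U : GaugeField (D.F.P D.K) 0 G) (k : ℕ) (Y : 𝒴), Measurable fun x : Ω => L.pRA r U k x Y)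
    (hbdB : ∀ (g : ℕ → ℝ) (U : D.carriers.BgB) (k : ℕ),
      FormatBounded (L.W k).format (rawBOfRecordShift D ι c a s L.ΓB L.dkB L.gcB L.pQB L.pRB g U k).kernel)
    (hmQB : ∀ (r : ℝ) (U : GaugeField (D.F.P (D.K + 1)) 0 G) (k : ℕ) (Y : 𝒴) (b b' : ((Tor (unitMod (D.F.P D.K)) × Fin (D.F.P D.K).d) × o)),
        Measurable fun x : Ω => L.pQB r U k x Y b b')
    (hmRB : ∀ (r : ℝ) (U : GaugeField (D.F.P (D.K + 1)) 0 G) (k : ℕ) (Y : 𝒴), Measurable fun x : Ω => L.pRB r U k x Y)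
    -- E9[rec]'s binders VERBATIM at the instance
    (hbB : (assembly (readAtSlots (slotsOfRecordShift D ι c a s P 𝒵 dom Jc V mI L) ιbg)).SliceBudgetB W κ cB)
    (hbA : (readAtSlots (slotsOfRecordShift D ι c a s P 𝒵 dom Jc V mI L) ιbg).D.SliceBudget (step (readAtSlots (slotsOfRecordShift D ι c a s P 𝒵 dom Jc V mI L) ιbg) E₀ cB) W κ cA)
    (hdA : DecayBound (B13StepOfRecord.outA (readAtSlots (slotsOfRecordShift D ι c a s P 𝒵 dom Jc V mI L) ιbg) E₀ cB) W EA₀ κ)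
    (hdB : DecayBound (B13StepOfRecord.outB (readAtSlots (slotsOfRecordShift D ι c a s P 𝒵 dom Jc V mI L) ιbg) E₀ cB) W E₀ κ)
    (hRA : RawBounded (slotsOfRecordShift D ι c a s P 𝒵 dom Jc V mI L).F (assembly (slotsOfRecordShift D ι c a s P 𝒵 dom Jc V mI L)).rawAt W)
    (hRB : RawBounded (slotsOfRecordShift D ι c a s P 𝒵 dom Jc V mI L).F (slotsOfRecordShift D ι c a s P 𝒵 dom Jc V mI L).rawB W)
    (hwer : WeightedEntrywiseRate (slotsOfRecordShift D ι c a s P 𝒵 dom Jc V mI L).F (assembly (slotsOfRecordShift D ι c a s P 𝒵 dom Jc V mI L)).rawAt (slotsOfRecordShift D ι c a s P 𝒵 dom Jc V mI L).rawB W c₁ fun k => θ ^ k)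
    (hfl : ∀ k, r₀ ≤ L.rOp k)
    (hins : (step (readAtSlots (slotsOfRecordShift D ι c a s P 𝒵 dom Jc V mI L) ιbg) E₀ cB).InsertionRate W κ E₀ δ' θ)
    (hOp : ∀ k, L.rOp k ≤ ROp k) (hHist : ∀ k, (assembly (slotsOfRecordShift D ι c a s P 𝒵 dom Jc V mI L)).bHist E₀ cB k + L.rHist k ≤ RHist k)
    (hA : ∀ k, ∀ g ∈ W, ∀ (U : D.toTwoRuns.carriers.BgB) (q : (measOp T ((Tor (unitMod (D.F.P D.K)) × Fin (D.F.P D.K).d) × o) ι' Ω 𝒴) × B13HistM P),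
      q ∈ (ballClass (selfCtr (assemblyOn (restrict (readAtSlots (slotsOfRecordShift D ι c a s P 𝒵 dom Jc V mI L) ιbg) (measOp T ((Tor (unitMod (D.F.P D.K)) × Fin (D.F.P D.K).d) × o) ι' Ω 𝒴)
          (opA_mem_measOp_slotsOfRecordShift D ι c a s P 𝒵 dom Jc V mI L hbdA hmQA hmRA)
          (opB_mem_measOp_slotsOfRecordShift D ι c a s P 𝒵 dom Jc V mI L hbdB hmQB hmRB))).raw
        (assemblyOn (restrict (readAtSlots (slotsOfRecordShift D ι c a s P 𝒵 dom Jc V mI L) ιbg) (measOp T ((Tor (unitMod (D.F.P D.K)) × Fin (D.F.P D.K).d) × o) ι' Ω 𝒴)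
          (opA_mem_measOp_slotsOfRecordShift D ι c a s P 𝒵 dom Jc V mI L hbdA hmQA hmRA)
          (opB_mem_measOp_slotsOfRecordShift D ι c a s P 𝒵 dom Jc V mI L hbdB hmQB hmRB))).histRef) ROp RHist) k g U →
        ∀ X : D.toTwoRuns.carriers.Dom, D.toTwoRuns.carriers.scale X = k → ∀ i : TermIdx D.toTwoRuns.carriers.Dom (Bnd D.toTwoRuns),
          (labelsIndexing (domainGeometry D.toTwoRuns) (b13InnerData D.toTwoRuns)).Rel k i X → ∀ m,
            ‖(slotsOfRecordShift D ι c a s P 𝒵 dom Jc V mI L).act ((labelsIndexing (domainGeometry D.toTwoRuns) (b13InnerData D.toTwoRuns)).poly i m) ((labelsIndexing (domainGeometry D.toTwoRuns) (b13InnerData D.toTwoRuns)).lab i m) (q.1 : OpDatum (SpeciesRec D o T ι' Ω 𝒴)) q.2‖ ≤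
              A k g U ((labelsIndexing (domainGeometry D.toTwoRuns) (b13InnerData D.toTwoRuns)).poly i m) ((labelsIndexing (domainGeometry D.toTwoRuns) (b13InnerData D.toTwoRuns)).lab i m))
    (hA0 : ∀ k g U Z ℓ, 0 ≤ A k g U Z ℓ) (hA0' : ∀ k g U Z ℓ, 0 ≤ A' k g U Z ℓ) (hκ : 0 ≤ κ)
    (hdec : ∀ k g U Z ℓ, A k g U Z ℓ ≤ A' k g U Z ℓ * Real.exp (-(κ * (D.toTwoRuns.carriers.d Z + 5))))
    (hΦ0 : 0 ≤ Φ') (hΦsmall : 36 * Φ' < 1)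
    (hΦ : ∀ k, ∀ g ∈ W, ∀ (U : D.toTwoRuns.carriers.BgB) (q : SCube D.toTwoRuns),
      ∑ Z ∈ D.toTwoRuns.domAt k, ind (q ∈ footprint Z) * actSum (b13InnerData D.toTwoRuns) (A' k g U) k Z *
        Real.exp ((footprint Z).card) ≤ Φ')
    (hact : ActOpLineAnalyticOn (labelsIndexing (domainGeometry D.toTwoRuns) (b13InnerData D.toTwoRuns)) (restrict (readAtSlots (slotsOfRecordShift D ι c a s P 𝒵 dom Jc V mI L) ιbg) (measOp T ((Tor (unitMod (D.F.P D.K)) × Fin (D.F.P D.K).d) × o) ι' Ω 𝒴)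
          (opA_mem_measOp_slotsOfRecordShift D ι c a s P 𝒵 dom Jc V mI L hbdA hmQA hmRA)
          (opB_mem_measOp_slotsOfRecordShift D ι c a s P 𝒵 dom Jc V mI L hbdB hmQB hmRB)).act
      (ballClass (selfCtr (assemblyOn (restrict (readAtSlots (slotsOfRecordShift D ι c a s P 𝒵 dom Jc V mI L) ιbg) (measOp T ((Tor (unitMod (D.F.P D.K)) × Fin (D.F.P D.K).d) × o) ι' Ω 𝒴)
          (opA_mem_measOp_slotsOfRecordShift D ι c a s P 𝒵 dom Jc V mI L hbdA hmQA hmRA)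
          (opB_mem_measOp_slotsOfRecordShift D ι c a s P 𝒵 dom Jc V mI L hbdB hmQB hmRB))).raw
        (assemblyOn (restrict (readAtSlots (slotsOfRecordShift D ι c a s P 𝒵 dom Jc V mI L) ιbg) (measOp T ((Tor (unitMod (D.F.P D.K)) × Fin (D.F.P D.K).d) × o) ι' Ω 𝒴)
          (opA_mem_measOp_slotsOfRecordShift D ι c a s P 𝒵 dom Jc V mI L hbdA hmQA hmRA)
          (opB_mem_measOp_slotsOfRecordShift D ι c a s P 𝒵 dom Jc V mI L hbdB hmQB hmRB))).histRef) ROp RHist) W)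
    (hexp : ActExpLinearOn (labelsIndexing (domainGeometry D.toTwoRuns) (b13InnerData D.toTwoRuns)) (restrict (readAtSlots (slotsOfRecordShift D ι c a s P 𝒵 dom Jc V mI L) ιbg) (measOp T ((Tor (unitMod (D.F.P D.K)) × Fin (D.F.P D.K).d) × o) ι' Ω 𝒴)
          (opA_mem_measOp_slotsOfRecordShift D ι c a s P 𝒵 dom Jc V mI L hbdA hmQA hmRA)
          (opB_mem_measOp_slotsOfRecordShift D ι c a s P 𝒵 dom Jc V mI L hbdB hmQB hmRB)).act Dt
      (ballClass (selfCtr (assemblyOn (restrict (readAtSlots (slotsOfRecordShift D ι c a s P 𝒵 dom Jc V mI L) ιbg) (measOp T ((Tor (unitMod (D.F.P D.K)) × Fin (D.F.P D.K).d) × o) ι' Ω 𝒴)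
          (opA_mem_measOp_slotsOfRecordShift D ι c a s P 𝒵 dom Jc V mI L hbdA hmQA hmRA)
          (opB_mem_measOp_slotsOfRecordShift D ι c a s P 𝒵 dom Jc V mI L hbdB hmQB hmRB))).raw
        (assemblyOn (restrict (readAtSlots (slotsOfRecordShift D ι c a s P 𝒵 dom Jc V mI L) ιbg) (measOp T ((Tor (unitMod (D.F.P D.K)) × Fin (D.F.P D.K).d) × o) ι' Ω 𝒴)
          (opA_mem_measOp_slotsOfRecordShift D ι c a s P 𝒵 dom Jc V mI L hbdA hmQA hmRA)
          (opB_mem_measOp_slotsOfRecordShift D ι c a s P 𝒵 dom Jc V mI L hbdB hmQB hmRB))).histRef) ROp RHist) W)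
    (hE₀ : 0 ≤ E₀) (hcA : 0 ≤ cA) (hcB : 0 ≤ cB) (hc₁ : 0 ≤ c₁) (hr₀ : 0 < r₀) (hδ' : 0 ≤ δ')
    (hθ0 : 0 < θ) (hθ1 : θ < 1) (hθθ' : θ ≤ θ') (hθ'1 : θ' ≤ 1) (hω : 0 < L.ins.ω) (hω1 : L.ins.ω < 1)
    (hh : cA * (EA₀ + E₀) < 1 - L.ins.ω)
    (hsmall : L.ins.ω + Φ' / (1 - 36 * Φ') * cA * (1 - L.ins.ω) / (1 - L.ins.ω - cA * (EA₀ + E₀)) < θ') :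
    ∃ C₅, NE5 (B13StepOfRecord.outA (readAtSlots (slotsOfRecordShift D ι c a s P 𝒵 dom Jc V mI L) ιbg) E₀ cB)
      (B13StepOfRecord.outB (readAtSlots (slotsOfRecordShift D ι c a s P 𝒵 dom Jc V mI L) ιbg) E₀ cB) W κ θ' C₅ :=
  exists_ne5_of_record_measOp_envelope_readAt (slotsOfRecordShift D ι c a s P 𝒵 dom Jc V mI L) ιbg E₀ cB hbdA
    (fun g U k Y b b' => hmQA (g (k - 1)) U.1 k Y b b') (fun g U k Y => hmRA (g (k - 1)) U.1 k Y) hbdB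
    (fun g U k Y b b' => hmQB (g (k - 1)) U.1 k Y b b') (fun g U k Y => hmRB (g (k - 1)) U.1 k Y)
    (fun _ _ _ _ => measurable_const) (fun _ _ => measurable_const) hbB hbA hdA hdB hRA hRB hwer hfl hins hOp hHist hA hA0 hA0' hκ hdec hΦ0
    hΦsmall hΦ hact hexp hE₀ hcA hcB hc₁ hr₀ hδ' hθ0 hθ1 hθθ' hθ'1 hω hω1 hh hsmall

end Summit.QuantumFields.BalabanUV.T4Continuum.B13StepEnvelopeEndSubstrateShift

end
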